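import Summits.Ventures.HSemireg.WedgePointPairPowersPerQOverlap

/-!
# Venture HSemireg — C4's NAME for the `n`-fold box of `m`-dimensional point pairs: below the factor dimension the KERNEL of
# `θ ↦ θ ∧ F` is the span of the KILLED monomials (every `m`, `n`, `k < m`)

HONEST FRAMING. Part of the Lean index of the computation cell `pub-hsemireg` (seat p10 gen 6, Sunday typer «UNIFORM-IN-n»).
Finite-dimensional EXTERIOR ALGEBRA over a field ONLY: no variety, no cohomology theory, no sheaf, no Ext group and no
semiregularity map is constructed here; nothing here says that HC / HC_CM / HC_AV holds; no Literature fact is declared or used.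
Custodian versions cited: STRUCTURE.md v1.0-SIGNED 9b196a05977dd067 §1.1 C4 («ker ⌟ch(G) on HT²(Y) … DIMENSION 2n² uniform; SUBSPACE …
ker = H¹(T_X) ⊗ 1 ⊕ 1 ⊗ H¹(T_X′)», GS / gs-eng-1 THEOREM M / th-7 Cor A.4) and §2 (S1).

p10 gen 2 typed C4's NAME in th-7's TWO-factor model (`WedgeBoxKernelSpan.map_ker_wedgeMap_eq_span_killed`: for `k <` the factor
dimension the kernel of `θ ↦ θ ∧ box` is the span of the killed monomials).  THIS FILE does it for the `n`-FOLD box of `m`-dimensional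
point pairs of `WedgePointPairPowers*.lean` (p10 gen 3: generators `Fin ((m+m)·n)` in `n` blocks `X_i ⊔ Y_i`, box
`F = Π_i (a·E_{X_i} + c·E_{Y_i})`), uniformly in `m`, `n` and the degree `k < m`:
* a degree-`k` monomial `E_s` is ALIVE (`aliveSet`) if on every block its letters lie inside `X_i` or inside `Y_i`, KILLED
  (`killedSet`) otherwise (some block part meets both halves); a killed monomial is annihilated by `F` (`B_mul_pairBox_eq_zero_of_not_alive`: its block image
  `E_t ∧ (a E_X + c E_Y)` vanishes);
* for `k < m` the alive `k`-monomials are in BIJECTION with th-7's canonical source families of degree `k` (`Kset m n k` of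
  `WedgePointPairPowersPerQOverlap`: block part `t ↦` the canonical source `t`, no top collapse being possible below `m` letters), so
  **`card_aliveSet`: `#alive = |Kset m n k| = [t^k] P_m(t)ⁿ`** (`card_Kset`) `= rank(θ ↦ θ ∧ F ∣ ⋀^k)` (`finrank_range_wedge_pairBox_eq_card`);
* hence **`map_ker_wedge_pairBox_eq_span_killed`: for every field, `m ≥ 1`, `n`, `k < m`, `a, c ≠ 0`, the kernel of `θ ↦ θ ∧ F` on
  `⋀^k K^{(m+m)n}` IS the span of the killed monomials** (⊇ directly; `=` by rank–nullity: `dim ⋀^k = C((m+m)n, k) = #alive + #killed`),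
  **`finrank_ker_wedge_pairBox`: `dim ker = #killed = C((m+m)n, k) − [t^k] P_mⁿ`** — below the factor dimension no kernel vector is a
  genuine combination of alive monomials; in the dictionary (quoted, not asserted: `X_i ↔ H⁰(T_{X_i})`-, `Y_i ↔ H¹(𝒪_{X_i})`-type
  directions) the killed 2-monomials are the SPLIT PAIRS `x_i ∧ y_i` (§4: `killedSet_two_eq_splitPairs`, `card_splitPairs` = `n·m²`,
  **`finrank_ker_wedge_pairBox_two`**: `dim ker = n·m²` for `m ≥ 3`, `map_ker_wedge_pairBox_two_eq_span_splitPairs`) = the split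
  first-order deformation directions `⊕_i H¹(T_{X_i})` — C4's `2n²` at two factors of dimension `n`.
NOT here: degrees `k ≥ m` (top collapses add binomial kernel vectors `c·E_{…Y_i…} ∓ a·E_{…X_i…}`, cf. th-7's purity drop); the Ext side.
Namespace `Summit.Ventures.HSemireg.Wedge.PairPowers`; new names only.
-/

open Module Set Set.powersetCard Polynomial

namespace Summit.Ventures.HSemireg.Wedge.PairPowers

open Summit.Ventures.HSemireg.Wedge Summit.Ventures.HSemireg.Wedge.Kunneth

variable (K : Type*) [Field K] {m n : ℕ}

/-! ## §1. Alive and killed monomials -/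

variable (m n)

/-- the ALIVE `k`-subsets: on every block the letters avoid `Y_i` or avoid `X_i` (i.e. lie inside `X_i` or inside `Y_i`). -/
def aliveSet (k : ℕ) : Finset (Finset (Fin ((m + m) * n))) :=
  (Finset.univ.powersetCard k).filter fun s => ∀ i : Fin n, Disjoint (pb m n i s) (Ys m) ∨ Disjoint (pb m n i s) (Xs m)

/-- the KILLED `k`-subsets: some block part meets both halves. -/
def killedSet (k : ℕ) : Finset (Finset (Fin ((m + m) * n))) :=
  (Finset.univ.powersetCard k).filter fun s => ¬ ∀ i : Fin n, Disjoint (pb m n i s) (Ys m) ∨ Disjoint (pb m n i s) (Xs m)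

variable {m n}

/-- membership in `aliveSet`. -/
lemma mem_aliveSet {k : ℕ} {s : Finset (Fin ((m + m) * n))} :
    s ∈ aliveSet m n k ↔ s.card = k ∧ ∀ i : Fin n, Disjoint (pb m n i s) (Ys m) ∨ Disjoint (pb m n i s) (Xs m) := by
  simp only [aliveSet, Finset.mem_filter, Finset.mem_powersetCard, Finset.subset_univ, true_and]

/-- membership in `killedSet`. -/
lemma mem_killedSet {k : ℕ} {s : Finset (Fin ((m + m) * n))} :
    s ∈ killedSet m n k ↔ s.card = k ∧ ¬ ∀ i : Fin n, Disjoint (pb m n i s) (Ys m) ∨ Disjoint (pb m n i s) (Xs m) := by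
  simp only [killedSet, Finset.mem_filter, Finset.mem_powersetCard, Finset.subset_univ, true_and]

/-- `#alive + #killed = C((m+m)n, k)`. -/
lemma card_aliveSet_add_card_killedSet (k : ℕ) :
    (aliveSet m n k).card + (killedSet m n k).card = ((m + m) * n).choose k := by
  rw [aliveSet, killedSet, Finset.card_filter_add_card_filter_not, Finset.card_powersetCard, Finset.card_univ, Fintype.card_fin]

/-- the local image of a block part meeting BOTH halves vanishes: `E_t ∧ (a E_X + c E_Y) = 0`. -/
lemma B_mul_pp_eq_zero_of_not_disjoint (a c : K) {t : Finset (Fin (m + m))} (hY : ¬ Disjoint t (Ys m)) (hX : ¬ Disjoint t (Xs m)) :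
    B K (Fin (m + m)) t * pp K m a c = 0 := by
  rw [B_mul_pp, u_eq_zero K hX, u_eq_zero K hY, mul_zero, mul_zero, zero_smul, zero_smul, add_zero]

/-- **a KILLED monomial is annihilated by the box**: `E_s ∧ F = 0` (`m ≥ 1`, `a, c ≠ 0`). -/
theorem B_mul_pairBox_eq_zero_of_not_alive (hm : 1 ≤ m) {a c : K} (ha : a ≠ 0) (hc : c ≠ 0) {s : Finset (Fin ((m + m) * n))}
    (hs : ¬ ∀ i : Fin n, Disjoint (pb m n i s) (Ys m) ∨ Disjoint (pb m n i s) (Xs m)) :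
    B K (Fin ((m + m) * n)) s * pairBox K (m := m) (n := n) a c = 0 := by
  obtain ⟨i, hi⟩ := not_forall.mp hs
  rw [not_or] at hi
  obtain ⟨μ, -, e⟩ := B_mul_pairBox K hm ha hc s
  rw [e, lprod_eq_zero_of_limg K a c s i (by rw [limg_eq_emb, B_mul_pp_eq_zero_of_not_disjoint K a c hi.1 hi.2, map_zero]),
    smul_zero]

/-! ## §2. Below the factor dimension, alive monomials ↔ canonical source families -/

/-- an alive block part with fewer than `m` letters is a canonical local source. -/
lemma mem_optSet_of_alive {t : Finset (Fin (m + m))} (ht : Disjoint t (Ys m) ∨ Disjoint t (Xs m)) (hcard : t.card < m) :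
    t ∈ optSet m := by
  rw [mem_optSet]
  rcases ht with hY | hX
  · exact Or.inl (WedgePair.disjoint_Y_iff_subset_X.mp hY)
  · by_cases h0 : t = ∅
    · exact Or.inl (h0 ▸ Finset.empty_subset _)
    · exact Or.inr ⟨WedgePair.disjoint_X_iff_subset_Y.mp hX, Finset.card_pos.mpr (Finset.nonempty_iff_ne_empty.mpr h0), hcard⟩

/-- a canonical local source is alive. -/
lemma alive_of_mem_optSet {t : Finset (Fin (m + m))} (ht : t ∈ optSet m) : Disjoint t (Ys m) ∨ Disjoint t (Xs m) := by
  rcases mem_optSet.mp ht with hX | ⟨hY, -, -⟩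
  · exact Or.inl (WedgePair.disjoint_Y_iff_subset_X.mpr hX)
  · exact Or.inr (WedgePair.disjoint_X_iff_subset_Y.mpr hY)

/-- each block part of a `k`-set has at most `k` letters. -/
lemma card_pb_le (s : Finset (Fin ((m + m) * n))) (i : Fin n) : (pb m n i s).card ≤ s.card := by
  rw [card_eq_sum_card_pb s]
  exact Finset.single_le_sum (f := fun j => (pb m n j s).card) (fun j _ => Nat.zero_le _) (Finset.mem_univ i)

/-- gluing the block parts of `s` back gives `s`: `src (i ↦ pb_i s) = s`. -/
lemma biUnion_lift_pb (s : Finset (Fin ((m + m) * n))) : (Finset.univ.biUnion fun i => lift m n i (pb m n i s)) = s := by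
  ext x
  rw [Finset.mem_biUnion]
  constructor
  · rintro ⟨i, -, h⟩
    rw [lift_pb, Finset.mem_inter] at h
    exact h.1
  · intro hx
    refine ⟨⟨x / (m + m), div_lt x⟩, Finset.mem_univ _, ?_⟩
    rw [lift_pb, Finset.mem_inter]
    exact ⟨hx, mem_D_div x⟩

/-- the source family of an alive `k`-set, `k < m`: block `i ↦` its block part, a canonical local source. -/
def toSrc {k : ℕ} (hk : k < m) (s : aliveSet m n k) : Fin n → Opt m := fun i =>
  ⟨pb m n i s.1, mem_optSet_of_alive ((mem_aliveSet.mp s.2).2 i)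
    (lt_of_le_of_lt (card_pb_le s.1 i) (by rw [(mem_aliveSet.mp s.2).1]; exact hk))⟩

/-- **for `k < m` the alive `k`-sets are in bijection with the canonical source families of degree `k`** (`Kset m n k`). -/
theorem card_aliveSet_eq_card_Kset {k : ℕ} (hk : k < m) : (aliveSet m n k).card = (Kset m n k).card := by
  refine Finset.card_bij' (fun s hs => toSrc hk ⟨s, hs⟩) (fun f _ => src f) (fun s hs => ?_) (fun f hf => ?_) (fun s hs => ?_)
    (fun f hf => ?_)
  · rw [mem_Kset, kf]
    show ∑ i, (pb m n i s).card = k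
    rw [← card_eq_sum_card_pb s]
    exact (mem_aliveSet.mp hs).1
  · rw [mem_aliveSet, ← kf_eq_card_src, mem_Kset.mp hf]
    exact ⟨rfl, fun i => by rw [pb_src]; exact alive_of_mem_optSet (f i).2⟩
  · exact biUnion_lift_pb s
  · funext i
    exact Subtype.ext (pb_src f i)

/-- **`#alive = [t^k] P_m(t)ⁿ = rank(θ ↦ θ ∧ F ∣ ⋀^k)`** for `k < m` (`card_Kset`; `m ≥ 1`). -/
theorem card_aliveSet (hm : 1 ≤ m) {k : ℕ} (hk : k < m) : (aliveSet m n k).card = (pairPoly m ^ n).coeff k := by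
  rw [card_aliveSet_eq_card_Kset hk, card_Kset hm]

/-! ## §3. The kernel is the span of the killed monomials (`k < m`) -/

/-- the killed monomials lie in the kernel of `θ ↦ θ ∧ F` on `⋀^k`. -/
lemma span_killed_le_map_ker (hm : 1 ≤ m) {a c : K} (ha : a ≠ 0) (hc : c ≠ 0) (k : ℕ) :
    Submodule.span K (Set.range fun s : killedSet m n k => B K (Fin ((m + m) * n)) s.1) ≤
      (LinearMap.ker (wedge K (Fin ((m + m) * n)) k (pairBox K (m := m) (n := n) a c))).map
        (⋀[K]^k (Fin ((m + m) * n) → K)).subtype := by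
  rw [Submodule.span_le]
  rintro _ ⟨⟨s, hs⟩, rfl⟩
  have hmem : B K (Fin ((m + m) * n)) s ∈ ⋀[K]^k (Fin ((m + m) * n) → K) :=
    SurfacePowers.B_mem_exteriorPower K (mem_killedSet.mp hs).1
  refine ⟨⟨B K (Fin ((m + m) * n)) s, hmem⟩, ?_, rfl⟩
  rw [SetLike.mem_coe, LinearMap.mem_ker]
  exact B_mul_pairBox_eq_zero_of_not_alive K hm ha hc (mem_killedSet.mp hs).2

/-- `dim ⋀^k K^N = C(N, k)` for the generators `Fin N`. -/
lemma finrank_exteriorPower_fin (N k : ℕ) : finrank K (⋀[K]^k (Fin N → K)) = N.choose k := by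
  rw [exteriorPower.finrank_eq, Module.finrank_fintype_fun_eq_card, Fintype.card_fin]

/-- rank–nullity bookkeeping: `dim ker(θ ↦ θ ∧ F ∣ ⋀^k) = #killed` for `k < m`. -/
theorem finrank_ker_wedge_pairBox_aux (hm : 1 ≤ m) {k : ℕ} (hk : k < m) {a c : K} (ha : a ≠ 0) (hc : c ≠ 0) :
    finrank K (LinearMap.ker (wedge K (Fin ((m + m) * n)) k (pairBox K (m := m) (n := n) a c))) = (killedSet m n k).card := by
  have h1 := LinearMap.finrank_range_add_finrank_ker (wedge K (Fin ((m + m) * n)) k (pairBox K (m := m) (n := n) a c))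
  have h2 : finrank K (LinearMap.range (wedge K (Fin ((m + m) * n)) k (pairBox K (m := m) (n := n) a c))) =
      (aliveSet m n k).card := by
    rw [finrank_range_wedge_pairBox_eq_card K hm ha hc, card_aliveSet_eq_card_Kset hk]
  have h3 : finrank K (⋀[K]^k (Fin ((m + m) * n) → K)) = (aliveSet m n k).card + (killedSet m n k).card := by
    rw [finrank_exteriorPower_fin, card_aliveSet_add_card_killedSet]
  rw [h2, h3] at h1
  omega

/-- **THE KERNEL AS A SUBSPACE, every `m ≥ 1`, `n`, `k < m`, `a, c ≠ 0`**: `ker(θ ↦ θ ∧ F ∣ ⋀^k K^{(m+m)n}) = span{E_s : s killed}`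
(as a subspace of `⋀ K^{(m+m)n}`).  ⊇ is §1; equality by rank–nullity: `C((m+m)n, k) = rank + dim ker` with `rank = #alive`
(§2) and `#alive + #killed = C((m+m)n, k)`. -/
theorem map_ker_wedge_pairBox_eq_span_killed (hm : 1 ≤ m) {k : ℕ} (hk : k < m) {a c : K} (ha : a ≠ 0) (hc : c ≠ 0) :
    (LinearMap.ker (wedge K (Fin ((m + m) * n)) k (pairBox K (m := m) (n := n) a c))).map
        (⋀[K]^k (Fin ((m + m) * n) → K)).subtype =
      Submodule.span K (Set.range fun s : killedSet m n k => B K (Fin ((m + m) * n)) s.1) := by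
  have hli : LinearIndependent K (fun s : killedSet m n k => B K (Fin ((m + m) * n)) s.1) :=
    (B K (Fin ((m + m) * n))).linearIndependent.comp (fun s : killedSet m n k => s.1) fun s s' h => Subtype.ext h
  refine (Submodule.eq_of_le_of_finrank_eq (span_killed_le_map_ker K hm ha hc k) ?_).symm
  rw [finrank_span_eq_card hli, Fintype.card_coe, Submodule.finrank_map_subtype_eq, finrank_ker_wedge_pairBox_aux K hm hk ha hc]

/-- **`dim ker(θ ↦ θ ∧ F ∣ ⋀^k K^{(m+m)n}) = C((m+m)n, k) − [t^k] P_m(t)ⁿ`** for every field, `m ≥ 1`, `n`, `k < m`, `a, c ≠ 0`. -/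
theorem finrank_ker_wedge_pairBox (hm : 1 ≤ m) {k : ℕ} (hk : k < m) {a c : K} (ha : a ≠ 0) (hc : c ≠ 0) :
    finrank K (LinearMap.ker (wedge K (Fin ((m + m) * n)) k (pairBox K (m := m) (n := n) a c))) =
      ((m + m) * n).choose k - (pairPoly m ^ n).coeff k := by
  rw [finrank_ker_wedge_pairBox_aux K hm hk ha hc, ← card_aliveSet_add_card_killedSet (m := m) (n := n) k, card_aliveSet hm hk,
    Nat.add_sub_cancel_left]

/-- … and **`#killed = C((m+m)n, k) − [t^k] P_m(t)ⁿ`** (`k < m`, `m ≥ 1`): the kernel dimension in closed form. -/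
theorem card_killedSet_eq (hm : 1 ≤ m) {k : ℕ} (hk : k < m) :
    (killedSet m n k).card = ((m + m) * n).choose k - (pairPoly m ^ n).coeff k := by
  rw [← card_aliveSet_add_card_killedSet (m := m) (n := n) k, card_aliveSet hm hk, Nat.add_sub_cancel_left]

/-! ## §4. Degree 2: the killed 2-monomials are the `n·m²` SPLIT PAIRS `x_i ∧ y_i` (C4's name) -/

variable (m n)

/-- the SPLIT PAIRS: one `X`-letter and one `Y`-letter of the SAME block (`{x, y}`, `x ∈ X_i`, `y ∈ Y_i`). -/
def splitPairs : Finset (Finset (Fin ((m + m) * n))) :=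
  Finset.univ.biUnion fun i : Fin n => (lift m n i (Xs m) ×ˢ lift m n i (Ys m)).image fun p => {p.1, p.2}

variable {m n}

/-- an `X`-letter and a `Y`-letter are distinct. -/
lemma ne_of_mem_lift_Xs_Ys {i : Fin n} {x y : Fin ((m + m) * n)} (hx : x ∈ lift m n i (Xs m)) (hy : y ∈ lift m n i (Ys m)) :
    x ≠ y := by
  rintro rfl
  obtain ⟨j, hj, e⟩ := mem_lift.mp hx
  obtain ⟨j', hj', e'⟩ := mem_lift.mp hy
  have hjj : j = j' := (blockEmb m n i).injective (e.trans e'.symm)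
  subst hjj
  exact Finset.disjoint_left.mp (WedgePair.disjoint_XY m) hj hj'

/-- **in degree 2 the killed monomials are exactly the split pairs** (every `m`, `n`). -/
theorem killedSet_two_eq_splitPairs : killedSet m n 2 = splitPairs m n := by
  ext s
  rw [mem_killedSet, splitPairs, Finset.mem_biUnion]
  constructor
  · rintro ⟨hcard, hnot⟩
    obtain ⟨i, hi⟩ := not_forall.mp hnot
    rw [not_or, Finset.not_disjoint_iff, Finset.not_disjoint_iff] at hi
    obtain ⟨⟨jy, hjy, hjyY⟩, ⟨jx, hjx, hjxX⟩⟩ := hi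
    rw [mem_pb] at hjy hjx
    have hx : blockEmb m n i jx ∈ lift m n i (Xs m) := mem_lift.mpr ⟨jx, hjxX, rfl⟩
    have hy : blockEmb m n i jy ∈ lift m n i (Ys m) := mem_lift.mpr ⟨jy, hjyY, rfl⟩
    refine ⟨i, Finset.mem_univ _, Finset.mem_image.mpr ⟨(blockEmb m n i jx, blockEmb m n i jy), Finset.mem_product.mpr ⟨hx, hy⟩, ?_⟩⟩
    refine Finset.eq_of_subset_of_card_le (fun z hz => ?_) ?_
    · rcases Finset.mem_insert.mp hz with rfl | hz
      · exact hjx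
      · rw [Finset.mem_singleton] at hz; rw [hz]; exact hjy
    · rw [hcard, Finset.card_pair (ne_of_mem_lift_Xs_Ys hx hy)]
  · rintro ⟨i, -, hs⟩
    obtain ⟨⟨x, y⟩, hxy, rfl⟩ := Finset.mem_image.mp hs
    obtain ⟨hx, hy⟩ := Finset.mem_product.mp hxy
    refine ⟨Finset.card_pair (ne_of_mem_lift_Xs_Ys hx hy), not_forall.mpr ⟨i, ?_⟩⟩
    obtain ⟨jx, hjxX, ex⟩ := mem_lift.mp hx
    obtain ⟨jy, hjyY, ey⟩ := mem_lift.mp hy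
    rw [not_or, Finset.not_disjoint_iff, Finset.not_disjoint_iff]
    refine ⟨⟨jy, ?_, hjyY⟩, ⟨jx, ?_, hjxX⟩⟩
    · rw [mem_pb, ey]; exact Finset.mem_insert_of_mem (Finset.mem_singleton_self _)
    · rw [mem_pb, ex]; exact Finset.mem_insert_self _ _

/-- **there are `n·m²` split pairs**. -/
theorem card_splitPairs : (splitPairs m n).card = n * (m * m) := by
  rw [splitPairs, Finset.card_biUnion]
  · have h : ∀ i ∈ (Finset.univ : Finset (Fin n)),
        ((lift m n i (Xs m) ×ˢ lift m n i (Ys m)).image fun p => ({p.1, p.2} : Finset (Fin ((m + m) * n)))).card = m * m := by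
      intro i _
      rw [Finset.card_image_of_injOn, Finset.card_product, card_lift, card_lift, WedgePair.card_Xset, WedgePair.card_Yset]
      rintro ⟨x, y⟩ hxy ⟨x', y'⟩ hxy' h
      rw [Finset.mem_coe, Finset.mem_product] at hxy hxy'
      simp only at h
      -- `x` is the unique `X`-letter of `{x, y} = {x', y'}`
      have hx' : x ∈ ({x', y'} : Finset _) := h ▸ Finset.mem_insert_self x {y}
      have hxx : x = x' := by
        rcases Finset.mem_insert.mp hx' with h1 | h1
        · exact h1
        · rw [Finset.mem_singleton] at h1
          exact absurd h1 (ne_of_mem_lift_Xs_Ys hxy.1 hxy'.2)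
      have hy' : y ∈ ({x', y'} : Finset _) := h ▸ Finset.mem_insert_of_mem (Finset.mem_singleton_self y)
      have hyy : y = y' := by
        rcases Finset.mem_insert.mp hy' with h1 | h1
        · exact absurd h1.symm (ne_of_mem_lift_Xs_Ys hxy'.1 hxy.2)
        · rwa [Finset.mem_singleton] at h1
      rw [hxx, hyy]
    rw [Finset.sum_congr rfl h, Finset.sum_const, Finset.card_univ, Fintype.card_fin, smul_eq_mul]
  · intro i _ i' _ hii'
    rw [Function.onFun, Finset.disjoint_left]
    intro s hs hs'
    obtain ⟨⟨x, y⟩, hxy, rfl⟩ := Finset.mem_image.mp hs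
    obtain ⟨⟨x', y'⟩, hxy', e⟩ := Finset.mem_image.mp hs'
    rw [Finset.mem_product] at hxy hxy'
    have hxD : x ∈ D m n i := lift_subset_D i _ hxy.1
    have hx' : x ∈ ({x', y'} : Finset _) := e ▸ Finset.mem_insert_self x {y}
    have hxD' : x ∈ D m n i' := by
      rcases Finset.mem_insert.mp hx' with h1 | h1
      · rw [h1]; exact lift_subset_D i' _ hxy'.1
      · rw [Finset.mem_singleton] at h1; rw [h1]; exact lift_subset_D i' _ hxy'.2
    exact Finset.disjoint_left.mp (disjoint_D hii') hxD hxD'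

/-- **C4's NAME for the `n`-fold box: `dim ker(θ ↦ θ ∧ F ∣ ⋀² K^{(m+m)n}) = n·m²`** for every field, `m ≥ 3`, `n`, `a, c ≠ 0` — in the
quoted dictionary the split first-order deformation directions `⊕_i H⁰(T_{X_i}) ⊗ H¹(𝒪_{X_i}) = ⊕_i H¹(T_{X_i})` (`n·m²`; STRUCTURE C4's
`2n²` is the case of two factors of dimension `n`). -/
theorem finrank_ker_wedge_pairBox_two (hm : 3 ≤ m) {a c : K} (ha : a ≠ 0) (hc : c ≠ 0) :
    finrank K (LinearMap.ker (wedge K (Fin ((m + m) * n)) 2 (pairBox K (m := m) (n := n) a c))) = n * (m * m) := by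
  rw [finrank_ker_wedge_pairBox_aux K (by omega) (by omega) ha hc, killedSet_two_eq_splitPairs, card_splitPairs]

/-- … and AS A SUBSPACE: **`ker(θ ↦ θ ∧ F ∣ ⋀²) = span{x_i ∧ y_i}`**, the split pairs (`m ≥ 3`). -/
theorem map_ker_wedge_pairBox_two_eq_span_splitPairs (hm : 3 ≤ m) {a c : K} (ha : a ≠ 0) (hc : c ≠ 0) :
    (LinearMap.ker (wedge K (Fin ((m + m) * n)) 2 (pairBox K (m := m) (n := n) a c))).map
        (⋀[K]^2 (Fin ((m + m) * n) → K)).subtype =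
      Submodule.span K ((fun s => B K (Fin ((m + m) * n)) s) '' (splitPairs m n : Set (Finset (Fin ((m + m) * n))))) := by
  rw [map_ker_wedge_pairBox_eq_span_killed K (by omega) (by omega) ha hc, ← killedSet_two_eq_splitPairs, Set.image_eq_range]
  rfl

end Summit.Ventures.HSemireg.Wedge.PairPowers
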